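import Literature.AnabelianGeometry.EtaleTheta.SettingModelChiThetaCocycle
import Literature.AnabelianGeometry.EtaleTheta.SettingModelChiProp15ii
import HarnessLib

/-!
# The χ-twisted root model of [EtTh] §1: the choice `X̲̲` for the SECTION datum carrying the model's theta class,
# and the joint census `Prop13 ∧ Prop15i ∧ Prop15ii ∧ η̈^Θ ≠ 1 ∧ DoubleUnderline` at `modelχ` (R78 cluster, hand #2″, sequel)

Mochizuki, *The étale theta function …*, Publ. RIMS **45** (2009) [EtTh], Prop. 1.3 p. 20, Prop. 1.5 (i)/(ii) pp. 22–23,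
Def. 2.7 p. 41 [cite: MochizukiEtTh2009, Def 2.7 p.41].  abc-iut cell, layer L2, prover abc-iut-L2-d1 (gen 5); PROOF-ONLY
sequel of `SettingModelChiThetaCocycle` (this seat: `etaDdχ`, `eta_res_thetaCocycleχ`, `doubleUnderlineχOfEtaRes`)
answering abc-iut-L6-d5's COHERENCE FLAG (10:32Z): consumers that ALSO bind `Prop15ii` must take the étale-theta datum
over abc-iut-L2-t6's SECTION Kummer datum `kummerDataχSec p` (`SettingModelChiSectionPoints`: carrier
`H¹(G_{ℚ_p}, Δ_Θ)`, for which abc-iut-L6-d5 proved `Prop15i`/`Prop15ii`, `SettingModelChiProp15ii`), not over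
abc-iut-w5-d171's sub-object datum `kummerDataχ p`.  Since `EtaleThetaData.DoubleUnderline E l` depends on `E` only
through `E.etaDd`, the transport is one `doubleUnderlineχOfEtaRes` application:
* `doubleUnderlineχSec (l) (hl) : (etaleThetaDataχSec p (etaDdχ p)).DoubleUnderline l`;
* **`exists_etaleThetaData_prop13_prop15i_prop15ii_ne_one_doubleUnderline`** — at `modelχ` ONE étale-theta datum
  satisfies Prop. 1.3 (typed clauses), Prop. 1.5 (i), Prop. 1.5 (ii), has NON-TRIVIAL `η̈^Θ`, and admits the choice
  `X̲̲` (Def. 2.5 (i)/2.7, all six clauses) for every odd `l` — the E-indexed §1–§2 interface block is JOINTLY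
  non-vacuous at a model with genuine cyclotomic action.
SEMI-SYNTHETIC MODEL, consistency evidence only; nothing of [EtTh] asserted; no side taken on [IUTchIII] Cor. 3.12.
-/

noncomputable section

namespace Literature.AnabelianGeometry.EtaleTheta.SettingModel

open Literature.AnabelianGeometry.SemiGraphs

variable (p : ℕ) [Fact p.Prime]

/-- **The choice `X̲̲ := Huuχ p l` for the SECTION datum carrying the model's theta class `η̈^Θ = etaDdχ`** (all six
clauses of abc-iut-L2-t8's `DoubleUnderline`; `eta_res` by `eta_res_thetaCocycleχ`). [cite: MochizukiEtTh2009, Def 2.7 p.41] -/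
def doubleUnderlineχSec (l : ℕ+) (hl : Odd (l : ℕ)) : (etaleThetaDataχSec p (etaDdχ p)).DoubleUnderline l :=
  ThetaSetting.EtaleThetaData.doubleUnderlineχOfEtaRes p l hl _ (eta_res_thetaCocycleχ p l)

/-- [cite: MochizukiEtTh2009, Def 2.7 p.41] -/
theorem doubleUnderlineχSec_Huu (l : ℕ+) (hl : Odd (l : ℕ)) : (doubleUnderlineχSec p l hl).Huu = Huuχ p l := rfl

/-- The theta class of the section datum is the model's `η̈^Θ`, which is non-trivial. [cite: MochizukiEtTh2009, Prop 1.3 p.21] -/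
theorem etaDd_etaleThetaDataχSec_etaDdχ_ne_one : (etaleThetaDataχSec p (etaDdχ p)).etaDd ≠ 1 := etaDdχ_ne_one p

/-- **JOINT CENSUS at the χ-model**: one étale-theta datum `E` over `ThetaSetting.modelχ p` with
`Prop13 E`, `Prop15i E.toKummerData compat`, `Prop15ii E.toKummerData compat`, `E.etaDd ≠ 1`, and the choice `X̲̲`
(`E.DoubleUnderline l`) for every odd `l` — abc-iut-L2-t6's `prop13_etaleThetaDataχSec`, abc-iut-L6-d5's
`prop15i_kummerDataχSec` / `prop15ii_kummerDataχSec`, and this seat's `etaDdχ_ne_one` / `doubleUnderlineχSec`.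
[cite: MochizukiEtTh2009, Def 2.7 p.41] -/
theorem exists_etaleThetaData_prop13_prop15i_prop15ii_ne_one_doubleUnderline :
    ∃ E : (ThetaSetting.modelχ p).EtaleThetaData,
      ThetaSetting.Prop13 E ∧
        ThetaSetting.Prop15i E.toKummerData (ThetaSetting.modelχ p).compat ∧
          ThetaSetting.Prop15ii E.toKummerData (ThetaSetting.modelχ p).compat ∧
            E.etaDd ≠ 1 ∧ ∀ l : ℕ+, Odd (l : ℕ) → Nonempty (E.DoubleUnderline l) :=
  ⟨etaleThetaDataχSec p (etaDdχ p), prop13_etaleThetaDataχSec p _, prop15i_kummerDataχSec p _,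
    prop15ii_kummerDataχSec p _, etaDdχ_ne_one p, fun l hl => ⟨doubleUnderlineχSec p l hl⟩⟩

/-- The same joint census together with the root-level guards of the model (`IsEtThOrigin`, `Sec2Hyps`).
[cite: MochizukiEtTh2009, Def 2.7 p.41] -/
theorem _root_.Literature.AnabelianGeometry.EtaleTheta.ThetaSetting.exists_isEtThOrigin_sec2Hyps_etaleThetaData_doubleUnderline :
    ∃ D : ThetaSetting p, D.IsEtThOrigin ∧ D.Sec2Hyps ∧
      ∃ E : D.EtaleThetaData, ThetaSetting.Prop13 E ∧ ThetaSetting.Prop15i E.toKummerData D.compat ∧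
        ThetaSetting.Prop15ii E.toKummerData D.compat ∧ E.etaDd ≠ 1 ∧
          ∀ l : ℕ+, Odd (l : ℕ) → Nonempty (E.DoubleUnderline l) :=
  ⟨ThetaSetting.modelχ p, ThetaSetting.modelχ_isEtThOrigin p, ThetaSetting.modelχ_sec2Hyps p,
    exists_etaleThetaData_prop13_prop15i_prop15ii_ne_one_doubleUnderline p⟩

end Literature.AnabelianGeometry.EtaleTheta.SettingModel

end
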